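import Literature.AnabelianGeometry.EtaleTheta.Discharge.Sec2Cor28iIsStandardChiCusp
import Literature.AnabelianGeometry.EtaleTheta.Discharge.Sec2OrbitEmbeddingCoeff
import HarnessLib

/-!
# [EtTh] Cor 2.8 (i) at the cusped inversion model `χ′`, III: the HEADLINE clause «`γ` preserves the property that
# `η̈^{Θ,ℤ×μ₂}` be of standard type» for EVERY topological automorphism `Γ` of `Π^tp_C` (not only inner ones; proof-only)

S. Mochizuki, *The étale theta function and its Frobenioid-theoretic manifestations* [EtTh], Publ. RIMS **45** (2009), §2,
Cor 2.8 (i) PRIMS PDF p.42 («`γ` preserves the property that … `η̈^{Θ,ℤ×μ₂}` … be of standard type»; proof of Thm 1.10: «`γ` maps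
[the decomposition groups over] `τ` to [those over] `τ^{±1}`»), Def 1.9 p.29, Def 2.7 p.41 (bib key `MochizukiEtTh2009`).

PROOF-ONLY companion (0 `def`, 0 `instance`, no new `Prop`; cell abc-iut, layer L2, seat abc-iut-f-151 gen 7 — block-F tranche 151's
row F-0640 `Cor28_i`; sequel of this seat's Part I `Sec2Cor28iIsStandardChiCusp` (p499029) and Part II `Sec2Cor28iEndKnitChiCusp`;
abc-iut-L2-lead R1055/R1119, VNEXT note N-C28I-1; every input BY NAME).  abc-iut-L2-t2's `ThetaOrbitData.Cor28_i` has FOUR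
conclusions; Part II proved all four for INNER `Γ = γ_y`.  Its FIRST conclusion (C1) — `IsStandardColl (transport Γ η̈^{Θ,ℤ×μ₂})`,
print's «`γ` preserves the property … of standard type» — holds at the χ′ section-route cover for EVERY topological automorphism
`Γ : Π^tp_C ≃ₜ* Π^tp_C` granted ONLY `Cor28_i`'s own binder `hDtau` («`Γ` maps `D_{τ^{±1}}` into `{D_τ, D_{τ⁻¹}}`», exact
set-stability as typed) — and NOT even `InducesOnTheta`: for `g ∈ D_τ`, `Γ g ∈ D_τ ∪ D_{τ⁻¹}`, BOTH of which are `b`-axis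
sections `s_u(G_K̈)` on which the model's theta cocycle VANISHES (Part I §1); so the `Γ`-transport of the orbit member `η̈^Θ`
itself (`σ = 1`) restricts TRIVIALLY to `D_τ`, whatever the coefficient automorphism `Γ_Θ`.
* §1 **`isStandardColl_transport_etaZMu2_of_dtau_stable`** — generic section-route cover over `inversionModelχ′` (ANY `CLevelData`,
  completion, section, `g`, `X̲̲`; `hE : E.etaDd = etaDdχ`; BOTH slots on `b`-sections: `D_τ ≤ s_u(G_K̈)`, `D_{τ′} ≤ s_{u′}(G_K̈)`),
  every `Γ`, every `Γ_Θ`, every `hY`;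
* §2 `isStandardColl_transport_etaZMu2_coverOfRecordχ'_tauχ'` — RESIDUAL ∅ at THE cover of record with the Def. 1.9 pair
  `tauχ′`/`tauInvχ′` (`p ≡ 1 (mod 4)`, every odd `l`, every once-punctured datum `eX`), for every `Γ` (for every prime `p` the
  generic §1 applies verbatim to the slot filling `Ü = 1 + p` of Part I's `isStandard_coverOfRecordχ'_anchoredPointχ'OfUnit`).
So at this cover the node's residual for NON-inner `Γ` is confined to the «determines up to `μ_n`» clauses C2–C4 (theta rigidity
under arbitrary automorphisms = print's Props 2.4/2.6, Thm 1.10 (i) BY NAME); C1 is unconditional in `Γ`.  HONEST FRAMING: semi-synthetic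
model = consistency / non-vacuity evidence for the TYPED interface only; the ∀-closure of `Cor28_i` over the interface is refuted
(abc-iut-w4-d051's `not_forall_cor28_i`); [EtTh] is refereed and nothing of it is asserted; no side is taken on [IUTchIII] Cor 3.12;
typed ≠ proved; instantiated ≠ endorsed.
-/

noncomputable section

namespace Literature.AnabelianGeometry.EtaleTheta

open Literature.AnabelianGeometry.SemiGraphs ThetaCovers Literature.IUT.HodgeArakelov
open _root_.Topology _root_.Function

namespace SettingModel

variable (p : ℕ) [Fact p.Prime]

/-! ## §1. C1 of `Cor28_i` for EVERY `Γ ∈ Aut_top(Π^tp_C)` at the section-route cover over `χ′` -/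

section AllGamma

variable {PC : Type} [Group PC] [TopologicalSpace PC] [IsTopologicalGroup PC] [T2Space PC]
variable (e : (MuTwoSetting.inversionModelχ' p).CLevelData)
  (ιC : (MuTwoSetting.inversionModelχ' p).GtpC →ₜ* PC) (hιC : IsProfiniteCompletion ιC)
  (hinj : Function.Injective ιC) (op : (MuTwoSetting.inversionModelχ' p).toThetaSetting.OncePuncturedData)
  {l : ℕ+} (hodd : Odd ((l : ℕ+) : ℕ))
  (s : ↥(MuTwoSetting.inversionModelχ' p).GK →* (MuTwoSetting.inversionModelχ' p).PiTemp)
  (hsa : ∀ σ, (MuTwoSetting.inversionModelχ' p).aug (s σ) = (σ : GQp p))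
  (hsZ : ∀ σ, (MuTwoSetting.inversionModelχ' p).toZ (s σ) = 1)
  (hιell : ∀ c ∈ (e.piCDataOf ιC hιC).augGK.ker, c ∉ (e.piCDataOf ιC hιC).PiX →
    ∀ d ∈ (e.piCDataOf ιC hιC).PiX ⊓ (e.piCDataOf ιC hιC).augGK.ker,
      c * d * c⁻¹ * d ∈ (e.piCDataOf ιC hιC).barTheta l)
  (hN : (((MuTwoSetting.inversionModelχ' p).GtpXu l).map (MuTwoSetting.inversionModelχ' p).inclX).Normal)
  (hY : ((MuTwoSetting.inversionModelχ' p).GtpY.map (MuTwoSetting.inversionModelχ' p).inclX).Normal)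
  {E : (MuTwoSetting.inversionModelχ' p).toThetaSetting.EtaleThetaData} (hE : E.etaDd = etaDdχ p)
  (C : E.DoubleUnderline (l : ℕ))
  (hK : (MuTwoSetting.inversionModelχ' p).barKerTp l ≤ C.Huu) (hsH : ∀ σ, s σ ∈ C.Huu)
  (τ τ' : ThetaSetting.NonCuspidalPoint E.toKummerData)

include hE

/-- **C1 of `Cor28_i` — «`γ` preserves the property that `η̈^{Θ,ℤ×μ₂}` be of standard type» — for EVERY topological automorphism
`Γ` of `Π^tp_C` and EVERY coefficient automorphism `Γ_Θ`**, at `ofEmbedding (orbitEmbeddingOfHuuOfSection …)` over `χ′` (class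
`etaDdχ`; both Def-1.9 slots on `b`-axis sections `D_τ ≤ s_u(G_K̈)`, `D_{τ′} ≤ s_{u′}(G_K̈)`), granted only `Cor28_i`'s own binder
`hDtau` (`Γ` maps each member of `Dtau = {D_τ, D_{τ′}}` to a member of `Dtau`) and `hY`: the transported class of `η̈^Θ` itself,
`g ↦ Γ_Θ⁻¹(F(Γ g))` with `F` the transport of the theta cocycle, is TRIVIAL on `D_τ`, since `Γ g ∈ D_τ ∪ D_{τ′}` and the theta
cocycle vanishes on both (Part I §1). [cite: MochizukiEtTh2009, Cor 2.8(i) p.42] -/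
theorem isStandardColl_transport_etaZMu2_of_dtau_stable
    (hq : (MuTwoSetting.inversionModelχ' p).toThetaSetting.Compat) (hS : (MuTwoSetting.inversionModelχ' p).toThetaSetting.Sec2Hyps)
    {g : (MuTwoSetting.inversionModelχ' p).GtpC} (hgX : g ∉ (MuTwoSetting.inversionModelχ' p).inclX.range)
    (hι' : C.IotaStable (e.conjX g))
    (u u' : (↥(ThetaSetting.modelχ p).Kdd)ˣ)
    (hτ : τ.Dpt ≤ (ThetaSetting.modelχ p).GKdd.map (sectionOfUnitχ p u))
    (hτ' : τ'.Dpt ≤ (ThetaSetting.modelχ p).GKdd.map (sectionOfUnitχ p u'))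
    (Γ : (e.temperedCoverDataOfHuuOfSection ιC hιC hinj op hodd s hsa hsZ hιell hN hY C hK hsH hgX hι').Gtp ≃ₜ*
      (e.temperedCoverDataOfHuuOfSection ιC hιC hinj op hodd s hsa hsZ hιell hN hY C hK hsH hgX hι').Gtp)
    (ΓΘ : (ThetaOrbitData.ofEmbedding
        (e.orbitEmbeddingOfHuuOfSection ιC hιC hinj op hodd s hsa hsZ hιell hN hY C hK hsH hgX hι' τ τ') hq hS).DeltaTheta ≃*
      (ThetaOrbitData.ofEmbedding
        (e.orbitEmbeddingOfHuuOfSection ιC hιC hinj op hodd s hsa hsZ hιell hN hY C hK hsH hgX hι' τ τ') hq hS).DeltaTheta)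
    (hDtau : ∀ Dt ∈ (ThetaOrbitData.ofEmbedding
        (e.orbitEmbeddingOfHuuOfSection ιC hιC hinj op hodd s hsa hsZ hιell hN hY C hK hsH hgX hι' τ τ') hq hS).Dtau,
      Dt.map Γ.toMulEquiv.toMonoidHom ∈ (ThetaOrbitData.ofEmbedding
        (e.orbitEmbeddingOfHuuOfSection ιC hιC hinj op hodd s hsa hsZ hιell hN hY C hK hsH hgX hι' τ τ') hq hS).Dtau)
    (hYmap : (e.temperedCoverDataOfHuuOfSection ιC hιC hinj op hodd s hsa hsZ hιell hN hY C hK hsH hgX hι').PiYddtp.map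
        Γ.toMulEquiv.toMonoidHom =
      (e.temperedCoverDataOfHuuOfSection ιC hιC hinj op hodd s hsa hsZ hιell hN hY C hK hsH hgX hι').PiYddtp) :
    (ThetaOrbitData.ofEmbedding
        (e.orbitEmbeddingOfHuuOfSection ιC hιC hinj op hodd s hsa hsZ hιell hN hY C hK hsH hgX hι' τ τ') hq hS).IsStandardColl
      ((ThetaOrbitData.ofEmbedding
          (e.orbitEmbeddingOfHuuOfSection ιC hιC hinj op hodd s hsa hsZ hιell hN hY C hK hsH hgX hι' τ τ') hq hS).transport _
        Γ hYmap ΓΘ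
        (ThetaOrbitData.ofEmbedding
          (e.orbitEmbeddingOfHuuOfSection ιC hιC hinj op hodd s hsa hsZ hιell hN hY C hK hsH hgX hι' τ τ') hq hS).etaZMu2) := by
  haveI := hq.GtpYdd_normal
  haveI : (e.orbitEmbeddingOfHuuOfSection ιC hιC hinj op hodd s hsa hsZ hιell hN hY C hK hsH hgX hι' τ τ').bot.Normal :=
    (e.orbitEmbeddingOfHuuOfSection ιC hιC hinj op hodd s hsa hsZ hιell hN hY C hK hsH hgX hι' τ τ').normal_bot
  -- the representative of the orbit member `σ = 1`: the theta cocycle itself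
  have hf₀ : ContH1.mk
        (ContH1.resCocycle (ThetaSetting.modelχ p).toTheta (ThetaSetting.modelχ p).DeltaTheta
          (ThetaSetting.modelχ p).GtpYdd_le_GtpY (thetaCocycleχ p)).1
        (ContH1.resCocycle (ThetaSetting.modelχ p).toTheta (ThetaSetting.modelχ p).DeltaTheta
          (ThetaSetting.modelχ p).GtpYdd_le_GtpY (thetaCocycleχ p)).2 =
      ContH1.conj (MuTwoSetting.inversionModelχ' p).toTheta (MuTwoSetting.inversionModelχ' p).toThetaSetting.DeltaTheta 1
        E.etaDd := by
    rw [ContH1.conj_one_apply, hE, etaDdχ_eq_mk]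
    rfl
  -- it vanishes on both slots' decomposition groups (Part I §1)
  have van : ∀ (v : (↥(ThetaSetting.modelχ p).Kdd)ˣ) (x : ↥(ThetaSetting.modelχ p).GtpYdd),
      (x : PiTpχ p) ∈ (ThetaSetting.modelχ p).GKdd.map (sectionOfUnitχ p v) →
        (ContH1.resCocycle (ThetaSetting.modelχ p).toTheta (ThetaSetting.modelχ p).DeltaTheta
          (ThetaSetting.modelχ p).GtpYdd_le_GtpY (thetaCocycleχ p)).1 x = 1 := by
    intro v x hx
    obtain ⟨σ, -, hσ⟩ := Subgroup.mem_map.1 hx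
    exact thetaCocycleFunχ_eq_one_of_left_eq_bPowGfp p _ (kappaUnitχ p v σ * kappaUnitχ p v σ)
      (by change (x : PiTpχ p).left = _; rw [← hσ]; rfl)
  -- the transported representative is `1` on `ι(D_τ ∩ Π^tp_{X̲̲}) ∪ ι(D_{τ′} ∩ Π^tp_{X̲̲})`
  have key : ∀ (y : ↥(e.temperedCoverDataOfHuuOfSection ιC hιC hinj op hodd s hsa hsZ hιell hN hY C hK hsH hgX hι').PiYddtp),
      ((y : (e.temperedCoverDataOfHuuOfSection ιC hιC hinj op hodd s hsa hsZ hιell hN hY C hK hsH hgX hι').Gtp) ∈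
          (e.orbitEmbeddingOfHuuOfSection ιC hιC hinj op hodd s hsa hsZ hιell hN hY C hK hsH hgX hι' τ τ').decompUU τ ∨
        (y : (e.temperedCoverDataOfHuuOfSection ιC hιC hinj op hodd s hsa hsZ hιell hN hY C hK hsH hgX hι').Gtp) ∈
          (e.orbitEmbeddingOfHuuOfSection ιC hιC hinj op hodd s hsa hsZ hιell hN hY C hK hsH hgX hι' τ τ').decompUU τ') →
      (e.orbitEmbeddingOfHuuOfSection ιC hιC hinj op hodd s hsa hsZ hιell hN hY C hK hsH hgX hι' τ τ').transport
          (ContH1.resCocycle (ThetaSetting.modelχ p).toTheta (ThetaSetting.modelχ p).DeltaTheta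
            (ThetaSetting.modelχ p).GtpYdd_le_GtpY (thetaCocycleχ p)).1 y = 1 := by
    intro y hy
    -- `y = ι g'` with `g'` in one of the two `D ∩ Π^tp_{X̲̲}`
    have hy' : ∃ g' : (MuTwoSetting.inversionModelχ' p).PiTemp,
        (g' ∈ τ.Dpt ⊓ C.Huu ∨ g' ∈ τ'.Dpt ⊓ C.Huu) ∧
        (e.orbitEmbeddingOfHuuOfSection ιC hιC hinj op hodd s hsa hsZ hιell hN hY C hK hsH hgX hι' τ τ').ι g' = y := by
      rcases hy with h | h
      · obtain ⟨g', hg', hgy⟩ := Subgroup.mem_map.1 h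
        exact ⟨g', Or.inl hg', hgy⟩
      · obtain ⟨g', hg', hgy⟩ := Subgroup.mem_map.1 h
        exact ⟨g', Or.inr hg', hgy⟩
    obtain ⟨g', hg', hgy⟩ := hy'
    have hg'Y : g' ∈ (MuTwoSetting.inversionModelχ' p).toThetaSetting.GtpYdd := by
      rcases hg' with h | h
      · exact τ.Dpt_le (Subgroup.mem_inf.1 h).1
      · exact τ'.Dpt_le (Subgroup.mem_inf.1 h).1
    have hpull : (e.orbitEmbeddingOfHuuOfSection ιC hιC hinj op hodd s hsa hsZ hιell hN hY C hK hsH hgX hι' τ τ').pull y =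
        ⟨g', hg'Y⟩ := by
      have := (e.orbitEmbeddingOfHuuOfSection ιC hιC hinj op hodd s hsa hsZ hιell hN hY C hK hsH hgX hι' τ τ').pull_ι ⟨g', hg'Y⟩
      convert this using 2
      exact Subtype.ext hgy.symm
    change (e.orbitEmbeddingOfHuuOfSection ιC hιC hinj op hodd s hsa hsZ hιell hN hY C hK hsH hgX hι' τ τ').coeffOf _ = 1
    rw [hpull]
    rcases hg' with h | h
    · exact (congrArg (e.orbitEmbeddingOfHuuOfSection ιC hιC hinj op hodd s hsa hsZ hιell hN hY C hK hsH hgX hι' τ τ').coeffOf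
        (van u ⟨g', hg'Y⟩ (hτ (Subgroup.mem_inf.1 h).1))).trans (e.orbitEmbeddingOfHuuOfSection ιC hιC hinj op hodd s hsa hsZ hιell hN hY C hK hsH hgX hι' τ τ').coeffOf_one
    · exact (congrArg (e.orbitEmbeddingOfHuuOfSection ιC hιC hinj op hodd s hsa hsZ hιell hN hY C hK hsH hgX hι' τ τ').coeffOf
        (van u' ⟨g', hg'Y⟩ (hτ' (Subgroup.mem_inf.1 h).1))).trans (e.orbitEmbeddingOfHuuOfSection ιC hιC hinj op hodd s hsa hsZ hιell hN hY C hK hsH hgX hι' τ τ').coeffOf_one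
  -- `Γ(D_τ) ∈ {D_τ, D_{τ′}}`
  have hΓD := hDtau _ (Or.inl rfl)
  refine ⟨_, Or.inl rfl, _, ⟨_, ⟨1, Set.mem_univ _, rfl⟩, rfl⟩, _,
    ⟨_, ⟨ContH1.resCocycle (ThetaSetting.modelχ p).toTheta (ThetaSetting.modelχ p).DeltaTheta
      (ThetaSetting.modelχ p).GtpYdd_le_GtpY (thetaCocycleχ p), hf₀, rfl⟩, rfl⟩, 1, fun x hx => ?_⟩
  have hΓx : (Γ x ∈ (e.orbitEmbeddingOfHuuOfSection ιC hιC hinj op hodd s hsa hsZ hιell hN hY C hK hsH hgX hι' τ τ').decompUU τ) ∨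
      (Γ x ∈ (e.orbitEmbeddingOfHuuOfSection ιC hιC hinj op hodd s hsa hsZ hιell hN hY C hK hsH hgX hι' τ τ').decompUU τ') := by
    rcases hΓD with h | h
    · exact Or.inl (h.le ⟨x, hx, rfl⟩)
    · exact Or.inr (h.le ⟨x, hx, rfl⟩)
  rw [map_one, one_mul, inv_one]
  change ΓΘ.symm ((e.orbitEmbeddingOfHuuOfSection ιC hιC hinj op hodd s hsa hsZ hιell hN hY C hK hsH hgX hι' τ τ').transport
      (ContH1.resCocycle (ThetaSetting.modelχ p).toTheta (ThetaSetting.modelχ p).DeltaTheta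
        (ThetaSetting.modelχ p).GtpYdd_le_GtpY (thetaCocycleχ p)).1 ⟨Γ x, _⟩) ^ 2 = 1
  rw [key _ hΓx]
  exact (congrArg (· ^ 2) (map_one ΓΘ.symm)).trans (one_pow 2)

end AllGamma

/-! ## §2. RESIDUAL ∅ at THE cover of record -/

/-- **C1 of `Cor28_i` for EVERY `Γ ∈ Aut_top(Π^tp_C)` at THE cover of record over `inversionModelχ′` with the Def. 1.9 pair
`τ := tauχ′`, `τ′ := tauInvχ′`** (`p ≡ 1 (mod 4)`, every odd `l`, every once-punctured datum `eX`): «`γ` preserves the property that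
`η̈^{Θ,ℤ×μ₂}` be of standard type», granted only `Cor28_i`'s own binders `hDtau`, `hY` (and ANY `Γ_Θ`) — every group-theoretic
input a theorem. [cite: MochizukiEtTh2009, Cor 2.8(i) p.42] -/
theorem isStandardColl_transport_etaZMu2_coverOfRecordχ'_tauχ' (hp : p % 4 = 1) (l : ℕ+) (hodd : Odd ((l : ℕ+) : ℕ))
    (eX : (MuTwoSetting.inversionModelχ' p).toThetaSetting.OncePuncturedData)
    (Γ : ((cLevelDataInvχ' p).temperedCoverDataOfHuuOfSection (cLevelDataInvχ' p).toPiCHat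
        (cLevelDataInvχ' p).isProfiniteCompletion_toPiCHat (cLevelDataInvχ' p).toPiCHat_injective eX hodd (sectionχ' p)
        (aug_sectionχ' p) (toZ_sectionχ' p) (inv_ell_piCData_inversionModelχ' p l eX)
        ((cLevelDataInvχ' p).map_inclX_GtpXu_normal l (kerToZIsCompactlyGenerated_modelχ' p))
        ((cLevelDataInvχ' p).map_inclX_GtpY_normal (kerToZIsCompactlyGenerated_modelχ' p)) (doubleUnderlineχ'Sec p l hodd)
        (barKerTp_le_Huuχ_inversionModelχ' p l hodd) (fun σ => inr_mem_Huuχ p l σ) (epsPMInvχ_not_mem_range p)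
        (iotaStable_conjX_epsPMInvχ' p (doubleUnderlineχ'Sec p l hodd) rfl)).Gtp ≃ₜ*
      ((cLevelDataInvχ' p).temperedCoverDataOfHuuOfSection (cLevelDataInvχ' p).toPiCHat
        (cLevelDataInvχ' p).isProfiniteCompletion_toPiCHat (cLevelDataInvχ' p).toPiCHat_injective eX hodd (sectionχ' p)
        (aug_sectionχ' p) (toZ_sectionχ' p) (inv_ell_piCData_inversionModelχ' p l eX)
        ((cLevelDataInvχ' p).map_inclX_GtpXu_normal l (kerToZIsCompactlyGenerated_modelχ' p))
        ((cLevelDataInvχ' p).map_inclX_GtpY_normal (kerToZIsCompactlyGenerated_modelχ' p)) (doubleUnderlineχ'Sec p l hodd)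
        (barKerTp_le_Huuχ_inversionModelχ' p l hodd) (fun σ => inr_mem_Huuχ p l σ) (epsPMInvχ_not_mem_range p)
        (iotaStable_conjX_epsPMInvχ' p (doubleUnderlineχ'Sec p l hodd) rfl)).Gtp)
    (ΓΘ : (ThetaOrbitData.ofEmbedding
      ((cLevelDataInvχ' p).orbitEmbeddingOfHuuOfSection (cLevelDataInvχ' p).toPiCHat
        (cLevelDataInvχ' p).isProfiniteCompletion_toPiCHat (cLevelDataInvχ' p).toPiCHat_injective eX hodd (sectionχ' p)
        (aug_sectionχ' p) (toZ_sectionχ' p) (inv_ell_piCData_inversionModelχ' p l eX)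
        ((cLevelDataInvχ' p).map_inclX_GtpXu_normal l (kerToZIsCompactlyGenerated_modelχ' p))
        ((cLevelDataInvχ' p).map_inclX_GtpY_normal (kerToZIsCompactlyGenerated_modelχ' p)) (doubleUnderlineχ'Sec p l hodd)
        (barKerTp_le_Huuχ_inversionModelχ' p l hodd) (fun σ => inr_mem_Huuχ p l σ) (epsPMInvχ_not_mem_range p)
        (iotaStable_conjX_epsPMInvχ' p (doubleUnderlineχ'Sec p l hodd) rfl)
        (tauχ' p hp).toNonCuspidalPoint (tauInvχ' p hp).toNonCuspidalPoint)
      (MuTwoSetting.inversionModelχ'_compat p) (ThetaSetting.modelχ'_sec2Hyps p)).DeltaTheta ≃*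
      (ThetaOrbitData.ofEmbedding
      ((cLevelDataInvχ' p).orbitEmbeddingOfHuuOfSection (cLevelDataInvχ' p).toPiCHat
        (cLevelDataInvχ' p).isProfiniteCompletion_toPiCHat (cLevelDataInvχ' p).toPiCHat_injective eX hodd (sectionχ' p)
        (aug_sectionχ' p) (toZ_sectionχ' p) (inv_ell_piCData_inversionModelχ' p l eX)
        ((cLevelDataInvχ' p).map_inclX_GtpXu_normal l (kerToZIsCompactlyGenerated_modelχ' p))
        ((cLevelDataInvχ' p).map_inclX_GtpY_normal (kerToZIsCompactlyGenerated_modelχ' p)) (doubleUnderlineχ'Sec p l hodd)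
        (barKerTp_le_Huuχ_inversionModelχ' p l hodd) (fun σ => inr_mem_Huuχ p l σ) (epsPMInvχ_not_mem_range p)
        (iotaStable_conjX_epsPMInvχ' p (doubleUnderlineχ'Sec p l hodd) rfl)
        (tauχ' p hp).toNonCuspidalPoint (tauInvχ' p hp).toNonCuspidalPoint)
      (MuTwoSetting.inversionModelχ'_compat p) (ThetaSetting.modelχ'_sec2Hyps p)).DeltaTheta)
    (hDtau : ∀ Dt ∈ (ThetaOrbitData.ofEmbedding
      ((cLevelDataInvχ' p).orbitEmbeddingOfHuuOfSection (cLevelDataInvχ' p).toPiCHat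
        (cLevelDataInvχ' p).isProfiniteCompletion_toPiCHat (cLevelDataInvχ' p).toPiCHat_injective eX hodd (sectionχ' p)
        (aug_sectionχ' p) (toZ_sectionχ' p) (inv_ell_piCData_inversionModelχ' p l eX)
        ((cLevelDataInvχ' p).map_inclX_GtpXu_normal l (kerToZIsCompactlyGenerated_modelχ' p))
        ((cLevelDataInvχ' p).map_inclX_GtpY_normal (kerToZIsCompactlyGenerated_modelχ' p)) (doubleUnderlineχ'Sec p l hodd)
        (barKerTp_le_Huuχ_inversionModelχ' p l hodd) (fun σ => inr_mem_Huuχ p l σ) (epsPMInvχ_not_mem_range p)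
        (iotaStable_conjX_epsPMInvχ' p (doubleUnderlineχ'Sec p l hodd) rfl)
        (tauχ' p hp).toNonCuspidalPoint (tauInvχ' p hp).toNonCuspidalPoint)
      (MuTwoSetting.inversionModelχ'_compat p) (ThetaSetting.modelχ'_sec2Hyps p)).Dtau,
      Dt.map Γ.toMulEquiv.toMonoidHom ∈ (ThetaOrbitData.ofEmbedding
      ((cLevelDataInvχ' p).orbitEmbeddingOfHuuOfSection (cLevelDataInvχ' p).toPiCHat
        (cLevelDataInvχ' p).isProfiniteCompletion_toPiCHat (cLevelDataInvχ' p).toPiCHat_injective eX hodd (sectionχ' p)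
        (aug_sectionχ' p) (toZ_sectionχ' p) (inv_ell_piCData_inversionModelχ' p l eX)
        ((cLevelDataInvχ' p).map_inclX_GtpXu_normal l (kerToZIsCompactlyGenerated_modelχ' p))
        ((cLevelDataInvχ' p).map_inclX_GtpY_normal (kerToZIsCompactlyGenerated_modelχ' p)) (doubleUnderlineχ'Sec p l hodd)
        (barKerTp_le_Huuχ_inversionModelχ' p l hodd) (fun σ => inr_mem_Huuχ p l σ) (epsPMInvχ_not_mem_range p)
        (iotaStable_conjX_epsPMInvχ' p (doubleUnderlineχ'Sec p l hodd) rfl)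
        (tauχ' p hp).toNonCuspidalPoint (tauInvχ' p hp).toNonCuspidalPoint)
      (MuTwoSetting.inversionModelχ'_compat p) (ThetaSetting.modelχ'_sec2Hyps p)).Dtau)
    (hYmap : ((cLevelDataInvχ' p).temperedCoverDataOfHuuOfSection (cLevelDataInvχ' p).toPiCHat
        (cLevelDataInvχ' p).isProfiniteCompletion_toPiCHat (cLevelDataInvχ' p).toPiCHat_injective eX hodd (sectionχ' p)
        (aug_sectionχ' p) (toZ_sectionχ' p) (inv_ell_piCData_inversionModelχ' p l eX)
        ((cLevelDataInvχ' p).map_inclX_GtpXu_normal l (kerToZIsCompactlyGenerated_modelχ' p))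
        ((cLevelDataInvχ' p).map_inclX_GtpY_normal (kerToZIsCompactlyGenerated_modelχ' p)) (doubleUnderlineχ'Sec p l hodd)
        (barKerTp_le_Huuχ_inversionModelχ' p l hodd) (fun σ => inr_mem_Huuχ p l σ) (epsPMInvχ_not_mem_range p)
        (iotaStable_conjX_epsPMInvχ' p (doubleUnderlineχ'Sec p l hodd) rfl)).PiYddtp.map Γ.toMulEquiv.toMonoidHom =
      ((cLevelDataInvχ' p).temperedCoverDataOfHuuOfSection (cLevelDataInvχ' p).toPiCHat
        (cLevelDataInvχ' p).isProfiniteCompletion_toPiCHat (cLevelDataInvχ' p).toPiCHat_injective eX hodd (sectionχ' p)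
        (aug_sectionχ' p) (toZ_sectionχ' p) (inv_ell_piCData_inversionModelχ' p l eX)
        ((cLevelDataInvχ' p).map_inclX_GtpXu_normal l (kerToZIsCompactlyGenerated_modelχ' p))
        ((cLevelDataInvχ' p).map_inclX_GtpY_normal (kerToZIsCompactlyGenerated_modelχ' p)) (doubleUnderlineχ'Sec p l hodd)
        (barKerTp_le_Huuχ_inversionModelχ' p l hodd) (fun σ => inr_mem_Huuχ p l σ) (epsPMInvχ_not_mem_range p)
        (iotaStable_conjX_epsPMInvχ' p (doubleUnderlineχ'Sec p l hodd) rfl)).PiYddtp) :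
    (ThetaOrbitData.ofEmbedding
      ((cLevelDataInvχ' p).orbitEmbeddingOfHuuOfSection (cLevelDataInvχ' p).toPiCHat
        (cLevelDataInvχ' p).isProfiniteCompletion_toPiCHat (cLevelDataInvχ' p).toPiCHat_injective eX hodd (sectionχ' p)
        (aug_sectionχ' p) (toZ_sectionχ' p) (inv_ell_piCData_inversionModelχ' p l eX)
        ((cLevelDataInvχ' p).map_inclX_GtpXu_normal l (kerToZIsCompactlyGenerated_modelχ' p))
        ((cLevelDataInvχ' p).map_inclX_GtpY_normal (kerToZIsCompactlyGenerated_modelχ' p)) (doubleUnderlineχ'Sec p l hodd)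
        (barKerTp_le_Huuχ_inversionModelχ' p l hodd) (fun σ => inr_mem_Huuχ p l σ) (epsPMInvχ_not_mem_range p)
        (iotaStable_conjX_epsPMInvχ' p (doubleUnderlineχ'Sec p l hodd) rfl)
        (tauχ' p hp).toNonCuspidalPoint (tauInvχ' p hp).toNonCuspidalPoint)
      (MuTwoSetting.inversionModelχ'_compat p) (ThetaSetting.modelχ'_sec2Hyps p)).IsStandardColl
      ((ThetaOrbitData.ofEmbedding
      ((cLevelDataInvχ' p).orbitEmbeddingOfHuuOfSection (cLevelDataInvχ' p).toPiCHat
        (cLevelDataInvχ' p).isProfiniteCompletion_toPiCHat (cLevelDataInvχ' p).toPiCHat_injective eX hodd (sectionχ' p)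
        (aug_sectionχ' p) (toZ_sectionχ' p) (inv_ell_piCData_inversionModelχ' p l eX)
        ((cLevelDataInvχ' p).map_inclX_GtpXu_normal l (kerToZIsCompactlyGenerated_modelχ' p))
        ((cLevelDataInvχ' p).map_inclX_GtpY_normal (kerToZIsCompactlyGenerated_modelχ' p)) (doubleUnderlineχ'Sec p l hodd)
        (barKerTp_le_Huuχ_inversionModelχ' p l hodd) (fun σ => inr_mem_Huuχ p l σ) (epsPMInvχ_not_mem_range p)
        (iotaStable_conjX_epsPMInvχ' p (doubleUnderlineχ'Sec p l hodd) rfl)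
        (tauχ' p hp).toNonCuspidalPoint (tauInvχ' p hp).toNonCuspidalPoint)
      (MuTwoSetting.inversionModelχ'_compat p) (ThetaSetting.modelχ'_sec2Hyps p)).transport _ Γ hYmap ΓΘ
      (ThetaOrbitData.ofEmbedding
      ((cLevelDataInvχ' p).orbitEmbeddingOfHuuOfSection (cLevelDataInvχ' p).toPiCHat
        (cLevelDataInvχ' p).isProfiniteCompletion_toPiCHat (cLevelDataInvχ' p).toPiCHat_injective eX hodd (sectionχ' p)
        (aug_sectionχ' p) (toZ_sectionχ' p) (inv_ell_piCData_inversionModelχ' p l eX)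
        ((cLevelDataInvχ' p).map_inclX_GtpXu_normal l (kerToZIsCompactlyGenerated_modelχ' p))
        ((cLevelDataInvχ' p).map_inclX_GtpY_normal (kerToZIsCompactlyGenerated_modelχ' p)) (doubleUnderlineχ'Sec p l hodd)
        (barKerTp_le_Huuχ_inversionModelχ' p l hodd) (fun σ => inr_mem_Huuχ p l σ) (epsPMInvχ_not_mem_range p)
        (iotaStable_conjX_epsPMInvχ' p (doubleUnderlineχ'Sec p l hodd) rfl)
        (tauχ' p hp).toNonCuspidalPoint (tauInvχ' p hp).toNonCuspidalPoint)
      (MuTwoSetting.inversionModelχ'_compat p) (ThetaSetting.modelχ'_sec2Hyps p)).etaZMu2) :=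
  isStandardColl_transport_etaZMu2_of_dtau_stable p (cLevelDataInvχ' p) _ _ _ eX hodd _ _ _ _ _ _ rfl
    (doubleUnderlineχ'Sec p l hodd) _ _ _ _ _ _ _ _ (sqrtNegOneUnitχ p hp) (sqrtNegOneInvUnitχ p hp) (Dpt_tauχ' p hp).le
    (Dpt_anchoredPointχ'OfUnit p _ _).le Γ ΓΘ hDtau hYmap

end SettingModel

end Literature.AnabelianGeometry.EtaleTheta

end
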